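import Summits.Ventures.YMGap.RobustBall.OneStateStarSU3
import Summits.Ventures.YMGap.RobustBall.StarRowsSU3PV2T
import Summits.Ventures.YMGap.RobustBall.AreaLawRowsSU3PV2T
import HarnessLib

/-!
# Venture YMGap, track ROBUST-BALL (Y2) — `SU(3)` HYPOTHESIS-FREE ONE-STATE cells on the TWISTED-constant (PV2T) star cells (`ℤ⁴`)

HONEST FRAMING. WHAT THIS IS: a venture file (cell `pub-ymgap`, track Y2 ROBUST-BALL, seat engine-2 (g11); 0 compute).  ds-3's one-state
composition `oneState_onBallZdG` (a `ℤ⁴` mass-gap cell × a torus area-law cell at the same loads ⇒ for every member of the gauge-invariant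
tier-1 ball: EXACTLY ONE DLR state = the infinite-volume limit of the member's PERIODISED torus states, massive, plaquette–plaquette decay,
Wilson area law with one `(C, c)` per range) applied to THIS SEAT's hypothesis-free `SU(3)` PV2T cells: the `ℤ⁴` star cells of
`StarRowsSU3PV2T` (`su3_massGapOnBallZdG_pv2tStar_*`, twisted one-link Poincaré constant `K_p + (97/50)R ≤ 12/7`) × the PV2T pair-door area law
`RobustBallPV.su3_areaLawOnBall_pv2t` at the same `(β_W, 2ε, ε)` (the area-law radius at these couplings is far above the star `ε`).  Class K outright.
* schema `su3_oneState_of_pv2tStar_row`: a PV2T area-law certificate at `(β_W, ε)` + a `MassGapOnBallZdG 4 3 (β_W/9) (2ε) ε R` cell ⇒ one state;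
* cells `su3_oneState_pv2tStar_*` `(β_W, ε)`: (1/8, .299) (1/6, .258) (1/5, .224) (1/4, .173) (3/10, .120) (1/3, .084) (17/50, .077) (3/8, .038) (2/5, .010).
WHAT MOVES: the hypothesis-free `SU(3)` one-state cells were g10's `OneStateStarSU3PV2` (4f66980a76c6; to (17/50, .011), frontier `17/50`); every cell
here is larger and the frontier moves `17/50 → 2/5`.  The one-state cells GIVEN H1, H2 (`OneStateStarSU3Certified`, to `11/20`) are untouched.
NOT CLAIMED: existence of the string tension for a non-Wilson member (only `HasAreaLawWith μ χ C c`); a range-uniform `(C, c)`; anything at weak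
coupling, about the continuum limit or the Millennium problem.

References: ds-3's `RobustBall/OneState.lean`, `OneStateStarSU3.lean`; this seat's `StarRowsSU3PV2T.lean`, `AreaLawRowsSU3PV2T.lean`,
`Thresholds/TwistedBochnerSU3.lean`, `OneLinkModulusSU3Twisted.lean`; certificates `HOME/pub-ymgap-engine-2/pv2t/cert_pv2t.json`.
-/


noncomputable section

open MeasureTheory Filter Topology Function Finset
open scoped NNReal
open Literature.Probability.LatticeModels
open Literature.MathematicalPhysics.QuantumLattice hiding torusNorm
open Literature.MathematicalPhysics.QuantumFieldTheory hiding ZdEdge Site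
open Literature.Barriers.QuantumFields (IsMassiveState)
open Summit.Ventures.YMGap.RobustBallPV (su3_areaLawOnBall_pv2t)

namespace Summit.Ventures.YMGap.RobustBall

/-- **SCHEMA, `SU(3)`, `ℤ⁴`, HYPOTHESIS-FREE one state on a PV2 star cell**: a PV2 pair-door area-law certificate at `(β_W, ε)` (radius
`R_al ≥ 2β_W/3`, `τ > 1`, envelope `K_s, s₀`, `T(2ε)(6(β_W/9)K_s) + T(ε)s₀ε < 1`) and a cell `MassGapOnBallZdG 4 3 (β_W/9) ε₀ ε R` with `ε₀ = 2ε`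
give ds-3's five one-state clauses for every member of `MemBallZdG ε₀ ε R`. [folklore] -/
theorem su3_oneState_of_pv2tStar_row {βW ε₀ ε Ral τ Ks s₀ Kp : ℝ} {R : ℕ} (h2 : 2 * ε = ε₀) (hε : 0 ≤ ε) (hβ0 : 0 ≤ βW)
    (hR : βW / 9 * (2 * ((3 : ℕ) : ℝ)) ≤ Ral) (hKp : 0 < Kp) (hKpR : Kp + 97 / 50 * Ral ≤ 12 / 7) (hτ : 1 < τ) (hKs0 : 0 ≤ Ks)
    (hKs : 48 * τ * (τ - 1) + 27 * τ ^ 3 * Ral ^ 2 ≤ 16 * (τ - 1) * (Kp * Ks ^ 2)) (hs0 : 0 ≤ s₀)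
    (hs : 1 ≤ Kp * s₀ ^ 2) (hε1 : ε ≤ 1 / 2)
    (hcert : (1 + 2 * ε + (2 * ε) ^ 2 / 2 + (2 * ε) ^ 3 / 6 + 5 / 96 * (2 * ε) ^ 4) * (2 * ((3 : ℕ) : ℝ) * (βW / 9) * Ks) +
      (1 + ε + ε ^ 2 / 2 + ε ^ 3 / 6 + 5 / 96 * ε ^ 4) * s₀ * ε < 1)
    (hgap : MassGapOnBallZdG 4 3 (βW / 9) ε₀ ε R) :
    ∃ C c : ℝ, 0 < c ∧ ∀ (W : Potential (ZdEdge 4) (SUN 3)) (supp : Finset (ZdEdge 4) → Finset (Finset (ZdEdge 4)))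
      (hmem : MemBallZdG ε₀ ε R W supp) (hdep : ∀ X, DependsOn (W X) (↑X : Set (ZdEdge 4)))
      (hg : ∀ X, IsZdGaugeInvariant (W X)) (hm : ∀ X, Measurable (W X)) (hb : ∀ X, ∃ C, ∀ U, |W X U| ≤ C),
      ∃ μ : Measure (LGConfig 4 (SUN 3)),
        perturbedGibbsMeasures (d := 4) (fundamentalRep (Fin 3)) (((3 : ℕ) : ℝ) * (βW / 9)) W supp = {μ} ∧
        perturbedLimitPoints (((3 : ℕ) : ℝ) * (βW / 9)) (periodisedFamily W supp hdep hg hm hb) = {μ} ∧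
        IsMassiveState μ ∧ HasExponentialDecay (plaquetteCorrFn (fundamentalRep (Fin 3)) μ) ∧
        HasAreaLawWith μ (fun g => normalisedCharacter 3 (fundamentalRep (Fin 3) g)) C c := by
  have hA := su3_areaLawOnBall_pv2t (n := 3) R (mv := 2 * R + 1) (by omega) hβ0 hR hKp hKpR hτ hKs0 hKs hs0 hs hε hε1 hcert
  have e : βW / 3 = ((3 : ℕ) : ℝ) * (βW / 9) := by push_cast; ring
  rw [e, h2] at hA
  exact oneState_onBallZdG (N := 3) (by norm_num) (by linarith) hε hgap hA

/-! ### Cells by name (hypothesis-free) -/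

/-- **`SU(3)`, `ℤ⁴`, `β_W = 1/8`, HYPOTHESIS-FREE**: every member of the gauge-invariant tier-1 ball `MemBallZdG (299 / 500) (299 / 1000) R` added to
`SU(3)` Wilson at `β_W = 1/8` ('t Hooft `1 / 72`) has ONE state (unique DLR state = periodised-torus limit, massive, plaquette decay, area law;
one `(C, c)` per `R`) — `su3_massGapOnBallZdG_pv2tStar_oneEighth` × the PV2T area law at the same loads (certificate `K_p = 6521 / 4200`, `τ = 531 / 500`, `K_s = 148251 / 100000`,
`s₀ = 401271 / 500000`). [folklore] -/
theorem su3_oneState_pv2tStar_oneEighth (R : ℕ) :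
    ∃ C c : ℝ, 0 < c ∧ ∀ (W : Potential (ZdEdge 4) (SUN 3)) (supp : Finset (ZdEdge 4) → Finset (Finset (ZdEdge 4)))
      (hmem : MemBallZdG (299 / 500) (299 / 1000) R W supp) (hdep : ∀ X, DependsOn (W X) (↑X : Set (ZdEdge 4)))
      (hg : ∀ X, IsZdGaugeInvariant (W X)) (hm : ∀ X, Measurable (W X)) (hb : ∀ X, ∃ C, ∀ U, |W X U| ≤ C),
      ∃ μ : Measure (LGConfig 4 (SUN 3)),
        perturbedGibbsMeasures (d := 4) (fundamentalRep (Fin 3)) (((3 : ℕ) : ℝ) * ((1 / 8 : ℝ) / 9)) W supp = {μ} ∧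
        perturbedLimitPoints (((3 : ℕ) : ℝ) * ((1 / 8 : ℝ) / 9)) (periodisedFamily W supp hdep hg hm hb) = {μ} ∧
        IsMassiveState μ ∧ HasExponentialDecay (plaquetteCorrFn (fundamentalRep (Fin 3)) μ) ∧
        HasAreaLawWith μ (fun g => normalisedCharacter 3 (fundamentalRep (Fin 3) g)) C c := by
  have hgap : MassGapOnBallZdG 4 3 ((1 / 8 : ℝ) / 9) (299 / 500) (299 / 1000) R := by
    have h := su3_massGapOnBallZdG_pv2tStar_oneEighth R; norm_num at h ⊢; exact h
  exact su3_oneState_of_pv2tStar_row (Ral := 1 / 12) (τ := 531 / 500) (Ks := 148251 / 100000) (s₀ := 401271 / 500000) (Kp := 6521 / 4200)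
    (by norm_num) (by norm_num) (by norm_num) (by norm_num) (by norm_num) (by norm_num) (by norm_num) (by norm_num) (by norm_num) (by norm_num) (by norm_num)
    (by norm_num) (by norm_num) hgap

/-- **`SU(3)`, `ℤ⁴`, `β_W = 1/6`, HYPOTHESIS-FREE**: every member of the gauge-invariant tier-1 ball `MemBallZdG (129 / 250) (129 / 500) R` added to
`SU(3)` Wilson at `β_W = 1/6` ('t Hooft `1 / 54`) has ONE state (unique DLR state = periodised-torus limit, massive, plaquette decay, area law;
one `(C, c)` per `R`) — `su3_massGapOnBallZdG_pv2tStar_oneSixth` × the PV2T area law at the same loads (certificate `K_p = 4721 / 3150`, `τ = 541 / 500`, `K_s = 154291 / 100000`,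
`s₀ = 816843 / 1000000`). [folklore] -/
theorem su3_oneState_pv2tStar_oneSixth (R : ℕ) :
    ∃ C c : ℝ, 0 < c ∧ ∀ (W : Potential (ZdEdge 4) (SUN 3)) (supp : Finset (ZdEdge 4) → Finset (Finset (ZdEdge 4)))
      (hmem : MemBallZdG (129 / 250) (129 / 500) R W supp) (hdep : ∀ X, DependsOn (W X) (↑X : Set (ZdEdge 4)))
      (hg : ∀ X, IsZdGaugeInvariant (W X)) (hm : ∀ X, Measurable (W X)) (hb : ∀ X, ∃ C, ∀ U, |W X U| ≤ C),
      ∃ μ : Measure (LGConfig 4 (SUN 3)),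
        perturbedGibbsMeasures (d := 4) (fundamentalRep (Fin 3)) (((3 : ℕ) : ℝ) * ((1 / 6 : ℝ) / 9)) W supp = {μ} ∧
        perturbedLimitPoints (((3 : ℕ) : ℝ) * ((1 / 6 : ℝ) / 9)) (periodisedFamily W supp hdep hg hm hb) = {μ} ∧
        IsMassiveState μ ∧ HasExponentialDecay (plaquetteCorrFn (fundamentalRep (Fin 3)) μ) ∧
        HasAreaLawWith μ (fun g => normalisedCharacter 3 (fundamentalRep (Fin 3) g)) C c := by
  have hgap : MassGapOnBallZdG 4 3 ((1 / 6 : ℝ) / 9) (129 / 250) (129 / 500) R := by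
    have h := su3_massGapOnBallZdG_pv2tStar_oneSixth R; norm_num at h ⊢; exact h
  exact su3_oneState_of_pv2tStar_row (Ral := 1 / 9) (τ := 541 / 500) (Ks := 154291 / 100000) (s₀ := 816843 / 1000000) (Kp := 4721 / 3150)
    (by norm_num) (by norm_num) (by norm_num) (by norm_num) (by norm_num) (by norm_num) (by norm_num) (by norm_num) (by norm_num) (by norm_num) (by norm_num)
    (by norm_num) (by norm_num) hgap

/-- **`SU(3)`, `ℤ⁴`, `β_W = 1/5`, HYPOTHESIS-FREE**: every member of the gauge-invariant tier-1 ball `MemBallZdG (56 / 125) (28 / 125) R` added to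
`SU(3)` Wilson at `β_W = 1/5` ('t Hooft `1 / 45`) has ONE state (unique DLR state = periodised-torus limit, massive, plaquette decay, area law;
one `(C, c)` per `R`) — `su3_massGapOnBallZdG_pv2tStar_oneFifth` × the PV2T area law at the same loads (certificate `K_p = 3821 / 2625`, `τ = 549 / 500`, `K_s = 19927 / 12500`,
`s₀ = 828851 / 1000000`). [folklore] -/
theorem su3_oneState_pv2tStar_oneFifth (R : ℕ) :
    ∃ C c : ℝ, 0 < c ∧ ∀ (W : Potential (ZdEdge 4) (SUN 3)) (supp : Finset (ZdEdge 4) → Finset (Finset (ZdEdge 4)))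
      (hmem : MemBallZdG (56 / 125) (28 / 125) R W supp) (hdep : ∀ X, DependsOn (W X) (↑X : Set (ZdEdge 4)))
      (hg : ∀ X, IsZdGaugeInvariant (W X)) (hm : ∀ X, Measurable (W X)) (hb : ∀ X, ∃ C, ∀ U, |W X U| ≤ C),
      ∃ μ : Measure (LGConfig 4 (SUN 3)),
        perturbedGibbsMeasures (d := 4) (fundamentalRep (Fin 3)) (((3 : ℕ) : ℝ) * ((1 / 5 : ℝ) / 9)) W supp = {μ} ∧
        perturbedLimitPoints (((3 : ℕ) : ℝ) * ((1 / 5 : ℝ) / 9)) (periodisedFamily W supp hdep hg hm hb) = {μ} ∧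
        IsMassiveState μ ∧ HasExponentialDecay (plaquetteCorrFn (fundamentalRep (Fin 3)) μ) ∧
        HasAreaLawWith μ (fun g => normalisedCharacter 3 (fundamentalRep (Fin 3) g)) C c := by
  have hgap : MassGapOnBallZdG 4 3 ((1 / 5 : ℝ) / 9) (56 / 125) (28 / 125) R := by
    have h := su3_massGapOnBallZdG_pv2tStar_oneFifth R; norm_num at h ⊢; exact h
  exact su3_oneState_of_pv2tStar_row (Ral := 2 / 15) (τ := 549 / 500) (Ks := 19927 / 12500) (s₀ := 828851 / 1000000) (Kp := 3821 / 2625)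
    (by norm_num) (by norm_num) (by norm_num) (by norm_num) (by norm_num) (by norm_num) (by norm_num) (by norm_num) (by norm_num) (by norm_num) (by norm_num)
    (by norm_num) (by norm_num) hgap

/-- **`SU(3)`, `ℤ⁴`, `β_W = 1/4`, HYPOTHESIS-FREE**: every member of the gauge-invariant tier-1 ball `MemBallZdG (173 / 500) (173 / 1000) R` added to
`SU(3)` Wilson at `β_W = 1/4` ('t Hooft `1 / 36`) has ONE state (unique DLR state = periodised-torus limit, massive, plaquette decay, area law;
one `(C, c)` per `R`) — `su3_massGapOnBallZdG_pv2tStar_oneQuarter` × the PV2T area law at the same loads (certificate `K_p = 2921 / 2100`, `τ = 561 / 500`, `K_s = 83817 / 50000`,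
`s₀ = 847899 / 1000000`). [folklore] -/
theorem su3_oneState_pv2tStar_oneQuarter (R : ℕ) :
    ∃ C c : ℝ, 0 < c ∧ ∀ (W : Potential (ZdEdge 4) (SUN 3)) (supp : Finset (ZdEdge 4) → Finset (Finset (ZdEdge 4)))
      (hmem : MemBallZdG (173 / 500) (173 / 1000) R W supp) (hdep : ∀ X, DependsOn (W X) (↑X : Set (ZdEdge 4)))
      (hg : ∀ X, IsZdGaugeInvariant (W X)) (hm : ∀ X, Measurable (W X)) (hb : ∀ X, ∃ C, ∀ U, |W X U| ≤ C),
      ∃ μ : Measure (LGConfig 4 (SUN 3)),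
        perturbedGibbsMeasures (d := 4) (fundamentalRep (Fin 3)) (((3 : ℕ) : ℝ) * ((1 / 4 : ℝ) / 9)) W supp = {μ} ∧
        perturbedLimitPoints (((3 : ℕ) : ℝ) * ((1 / 4 : ℝ) / 9)) (periodisedFamily W supp hdep hg hm hb) = {μ} ∧
        IsMassiveState μ ∧ HasExponentialDecay (plaquetteCorrFn (fundamentalRep (Fin 3)) μ) ∧
        HasAreaLawWith μ (fun g => normalisedCharacter 3 (fundamentalRep (Fin 3) g)) C c := by
  have hgap : MassGapOnBallZdG 4 3 ((1 / 4 : ℝ) / 9) (173 / 500) (173 / 1000) R := by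
    have h := su3_massGapOnBallZdG_pv2tStar_oneQuarter R; norm_num at h ⊢; exact h
  exact su3_oneState_of_pv2tStar_row (Ral := 1 / 6) (τ := 561 / 500) (Ks := 83817 / 50000) (s₀ := 847899 / 1000000) (Kp := 2921 / 2100)
    (by norm_num) (by norm_num) (by norm_num) (by norm_num) (by norm_num) (by norm_num) (by norm_num) (by norm_num) (by norm_num) (by norm_num) (by norm_num)
    (by norm_num) (by norm_num) hgap

/-- **`SU(3)`, `ℤ⁴`, `β_W = 3/10`, HYPOTHESIS-FREE**: every member of the gauge-invariant tier-1 ball `MemBallZdG (6 / 25) (3 / 25) R` added to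
`SU(3)` Wilson at `β_W = 3/10` ('t Hooft `1 / 30`) has ONE state (unique DLR state = periodised-torus limit, massive, plaquette decay, area law;
one `(C, c)` per `R`) — `su3_massGapOnBallZdG_pv2tStar_threeTenths` × the PV2T area law at the same loads (certificate `K_p = 2321 / 1750`, `τ = 143 / 125`, `K_s = 88273 / 50000`,
`s₀ = 217081 / 250000`). [folklore] -/
theorem su3_oneState_pv2tStar_threeTenths (R : ℕ) :
    ∃ C c : ℝ, 0 < c ∧ ∀ (W : Potential (ZdEdge 4) (SUN 3)) (supp : Finset (ZdEdge 4) → Finset (Finset (ZdEdge 4)))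
      (hmem : MemBallZdG (6 / 25) (3 / 25) R W supp) (hdep : ∀ X, DependsOn (W X) (↑X : Set (ZdEdge 4)))
      (hg : ∀ X, IsZdGaugeInvariant (W X)) (hm : ∀ X, Measurable (W X)) (hb : ∀ X, ∃ C, ∀ U, |W X U| ≤ C),
      ∃ μ : Measure (LGConfig 4 (SUN 3)),
        perturbedGibbsMeasures (d := 4) (fundamentalRep (Fin 3)) (((3 : ℕ) : ℝ) * ((3 / 10 : ℝ) / 9)) W supp = {μ} ∧
        perturbedLimitPoints (((3 : ℕ) : ℝ) * ((3 / 10 : ℝ) / 9)) (periodisedFamily W supp hdep hg hm hb) = {μ} ∧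
        IsMassiveState μ ∧ HasExponentialDecay (plaquetteCorrFn (fundamentalRep (Fin 3)) μ) ∧
        HasAreaLawWith μ (fun g => normalisedCharacter 3 (fundamentalRep (Fin 3) g)) C c := by
  have hgap : MassGapOnBallZdG 4 3 ((3 / 10 : ℝ) / 9) (6 / 25) (3 / 25) R := by
    have h := su3_massGapOnBallZdG_pv2tStar_threeTenths R; norm_num at h ⊢; exact h
  exact su3_oneState_of_pv2tStar_row (Ral := 1 / 5) (τ := 143 / 125) (Ks := 88273 / 50000) (s₀ := 217081 / 250000) (Kp := 2321 / 1750)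
    (by norm_num) (by norm_num) (by norm_num) (by norm_num) (by norm_num) (by norm_num) (by norm_num) (by norm_num) (by norm_num) (by norm_num) (by norm_num)
    (by norm_num) (by norm_num) hgap

/-- **`SU(3)`, `ℤ⁴`, `β_W = 1/3`, HYPOTHESIS-FREE**: every member of the gauge-invariant tier-1 ball `MemBallZdG (21 / 125) (21 / 250) R` added to
`SU(3)` Wilson at `β_W = 1/3` ('t Hooft `1 / 27`) has ONE state (unique DLR state = periodised-torus limit, massive, plaquette decay, area law;
one `(C, c)` per `R`) — `su3_massGapOnBallZdG_pv2tStar_oneThird` × the PV2T area law at the same loads (certificate `K_p = 2021 / 1575`, `τ = 29 / 25`, `K_s = 18291 / 10000`,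
`s₀ = 88279 / 100000`). [folklore] -/
theorem su3_oneState_pv2tStar_oneThird (R : ℕ) :
    ∃ C c : ℝ, 0 < c ∧ ∀ (W : Potential (ZdEdge 4) (SUN 3)) (supp : Finset (ZdEdge 4) → Finset (Finset (ZdEdge 4)))
      (hmem : MemBallZdG (21 / 125) (21 / 250) R W supp) (hdep : ∀ X, DependsOn (W X) (↑X : Set (ZdEdge 4)))
      (hg : ∀ X, IsZdGaugeInvariant (W X)) (hm : ∀ X, Measurable (W X)) (hb : ∀ X, ∃ C, ∀ U, |W X U| ≤ C),
      ∃ μ : Measure (LGConfig 4 (SUN 3)),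
        perturbedGibbsMeasures (d := 4) (fundamentalRep (Fin 3)) (((3 : ℕ) : ℝ) * ((1 / 3 : ℝ) / 9)) W supp = {μ} ∧
        perturbedLimitPoints (((3 : ℕ) : ℝ) * ((1 / 3 : ℝ) / 9)) (periodisedFamily W supp hdep hg hm hb) = {μ} ∧
        IsMassiveState μ ∧ HasExponentialDecay (plaquetteCorrFn (fundamentalRep (Fin 3)) μ) ∧
        HasAreaLawWith μ (fun g => normalisedCharacter 3 (fundamentalRep (Fin 3) g)) C c := by
  have hgap : MassGapOnBallZdG 4 3 ((1 / 3 : ℝ) / 9) (21 / 125) (21 / 250) R := by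
    have h := su3_massGapOnBallZdG_pv2tStar_oneThird R; norm_num at h ⊢; exact h
  exact su3_oneState_of_pv2tStar_row (Ral := 2 / 9) (τ := 29 / 25) (Ks := 18291 / 10000) (s₀ := 88279 / 100000) (Kp := 2021 / 1575)
    (by norm_num) (by norm_num) (by norm_num) (by norm_num) (by norm_num) (by norm_num) (by norm_num) (by norm_num) (by norm_num) (by norm_num) (by norm_num)
    (by norm_num) (by norm_num) hgap

/-- **`SU(3)`, `ℤ⁴`, `β_W = 17/50`, HYPOTHESIS-FREE**: every member of the gauge-invariant tier-1 ball `MemBallZdG (77 / 500) (77 / 1000) R` added to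
`SU(3)` Wilson at `β_W = 17/50` ('t Hooft `17 / 450`) has ONE state (unique DLR state = periodised-torus limit, massive, plaquette decay, area law;
one `(C, c)` per `R`) — `su3_massGapOnBallZdG_pv2tStar_seventeenFiftieths` × the PV2T area law at the same loads (certificate `K_p = 33457 / 26250`, `τ = 581 / 500`, `K_s = 92113 / 50000`,
`s₀ = 885771 / 1000000`). [folklore] -/
theorem su3_oneState_pv2tStar_seventeenFiftieths (R : ℕ) :
    ∃ C c : ℝ, 0 < c ∧ ∀ (W : Potential (ZdEdge 4) (SUN 3)) (supp : Finset (ZdEdge 4) → Finset (Finset (ZdEdge 4)))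
      (hmem : MemBallZdG (77 / 500) (77 / 1000) R W supp) (hdep : ∀ X, DependsOn (W X) (↑X : Set (ZdEdge 4)))
      (hg : ∀ X, IsZdGaugeInvariant (W X)) (hm : ∀ X, Measurable (W X)) (hb : ∀ X, ∃ C, ∀ U, |W X U| ≤ C),
      ∃ μ : Measure (LGConfig 4 (SUN 3)),
        perturbedGibbsMeasures (d := 4) (fundamentalRep (Fin 3)) (((3 : ℕ) : ℝ) * ((17 / 50 : ℝ) / 9)) W supp = {μ} ∧
        perturbedLimitPoints (((3 : ℕ) : ℝ) * ((17 / 50 : ℝ) / 9)) (periodisedFamily W supp hdep hg hm hb) = {μ} ∧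
        IsMassiveState μ ∧ HasExponentialDecay (plaquetteCorrFn (fundamentalRep (Fin 3)) μ) ∧
        HasAreaLawWith μ (fun g => normalisedCharacter 3 (fundamentalRep (Fin 3) g)) C c := by
  have hgap : MassGapOnBallZdG 4 3 ((17 / 50 : ℝ) / 9) (77 / 500) (77 / 1000) R := by
    have h := su3_massGapOnBallZdG_pv2tStar_seventeenFiftieths R; norm_num at h ⊢; exact h
  exact su3_oneState_of_pv2tStar_row (Ral := 17 / 75) (τ := 581 / 500) (Ks := 92113 / 50000) (s₀ := 885771 / 1000000) (Kp := 33457 / 26250)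
    (by norm_num) (by norm_num) (by norm_num) (by norm_num) (by norm_num) (by norm_num) (by norm_num) (by norm_num) (by norm_num) (by norm_num) (by norm_num)
    (by norm_num) (by norm_num) hgap

/-- **`SU(3)`, `ℤ⁴`, `β_W = 3/8`, HYPOTHESIS-FREE**: every member of the gauge-invariant tier-1 ball `MemBallZdG (19 / 250) (19 / 500) R` added to
`SU(3)` Wilson at `β_W = 3/8` ('t Hooft `1 / 24`) has ONE state (unique DLR state = periodised-torus limit, massive, plaquette decay, area law;
one `(C, c)` per `R`) — `su3_massGapOnBallZdG_pv2tStar_threeEighths` × the PV2T area law at the same loads (certificate `K_p = 1721 / 1400`, `τ = 589 / 500`, `K_s = 23923 / 12500`,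
`s₀ = 225483 / 250000`). [folklore] -/
theorem su3_oneState_pv2tStar_threeEighths (R : ℕ) :
    ∃ C c : ℝ, 0 < c ∧ ∀ (W : Potential (ZdEdge 4) (SUN 3)) (supp : Finset (ZdEdge 4) → Finset (Finset (ZdEdge 4)))
      (hmem : MemBallZdG (19 / 250) (19 / 500) R W supp) (hdep : ∀ X, DependsOn (W X) (↑X : Set (ZdEdge 4)))
      (hg : ∀ X, IsZdGaugeInvariant (W X)) (hm : ∀ X, Measurable (W X)) (hb : ∀ X, ∃ C, ∀ U, |W X U| ≤ C),
      ∃ μ : Measure (LGConfig 4 (SUN 3)),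
        perturbedGibbsMeasures (d := 4) (fundamentalRep (Fin 3)) (((3 : ℕ) : ℝ) * ((3 / 8 : ℝ) / 9)) W supp = {μ} ∧
        perturbedLimitPoints (((3 : ℕ) : ℝ) * ((3 / 8 : ℝ) / 9)) (periodisedFamily W supp hdep hg hm hb) = {μ} ∧
        IsMassiveState μ ∧ HasExponentialDecay (plaquetteCorrFn (fundamentalRep (Fin 3)) μ) ∧
        HasAreaLawWith μ (fun g => normalisedCharacter 3 (fundamentalRep (Fin 3) g)) C c := by
  have hgap : MassGapOnBallZdG 4 3 ((3 / 8 : ℝ) / 9) (19 / 250) (19 / 500) R := by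
    have h := su3_massGapOnBallZdG_pv2tStar_threeEighths R; norm_num at h ⊢; exact h
  exact su3_oneState_of_pv2tStar_row (Ral := 1 / 4) (τ := 589 / 500) (Ks := 23923 / 12500) (s₀ := 225483 / 250000) (Kp := 1721 / 1400)
    (by norm_num) (by norm_num) (by norm_num) (by norm_num) (by norm_num) (by norm_num) (by norm_num) (by norm_num) (by norm_num) (by norm_num) (by norm_num)
    (by norm_num) (by norm_num) hgap

/-- **`SU(3)`, `ℤ⁴`, `β_W = 2/5`, HYPOTHESIS-FREE**: every member of the gauge-invariant tier-1 ball `MemBallZdG (1 / 50) (1 / 100) R` added to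
`SU(3)` Wilson at `β_W = 2/5` ('t Hooft `2 / 45`) has ONE state (unique DLR state = periodised-torus limit, massive, plaquette decay, area law;
one `(C, c)` per `R`) — `su3_massGapOnBallZdG_pv2tStar_twoFifths` × the PV2T area law at the same loads (certificate `K_p = 3142 / 2625`, `τ = 297 / 250`, `K_s = 98383 / 50000`,
`s₀ = 914033 / 1000000`). [folklore] -/
theorem su3_oneState_pv2tStar_twoFifths (R : ℕ) :
    ∃ C c : ℝ, 0 < c ∧ ∀ (W : Potential (ZdEdge 4) (SUN 3)) (supp : Finset (ZdEdge 4) → Finset (Finset (ZdEdge 4)))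
      (hmem : MemBallZdG (1 / 50) (1 / 100) R W supp) (hdep : ∀ X, DependsOn (W X) (↑X : Set (ZdEdge 4)))
      (hg : ∀ X, IsZdGaugeInvariant (W X)) (hm : ∀ X, Measurable (W X)) (hb : ∀ X, ∃ C, ∀ U, |W X U| ≤ C),
      ∃ μ : Measure (LGConfig 4 (SUN 3)),
        perturbedGibbsMeasures (d := 4) (fundamentalRep (Fin 3)) (((3 : ℕ) : ℝ) * ((2 / 5 : ℝ) / 9)) W supp = {μ} ∧
        perturbedLimitPoints (((3 : ℕ) : ℝ) * ((2 / 5 : ℝ) / 9)) (periodisedFamily W supp hdep hg hm hb) = {μ} ∧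
        IsMassiveState μ ∧ HasExponentialDecay (plaquetteCorrFn (fundamentalRep (Fin 3)) μ) ∧
        HasAreaLawWith μ (fun g => normalisedCharacter 3 (fundamentalRep (Fin 3) g)) C c := by
  have hgap : MassGapOnBallZdG 4 3 ((2 / 5 : ℝ) / 9) (1 / 50) (1 / 100) R := by
    have h := su3_massGapOnBallZdG_pv2tStar_twoFifths R; norm_num at h ⊢; exact h
  exact su3_oneState_of_pv2tStar_row (Ral := 4 / 15) (τ := 297 / 250) (Ks := 98383 / 50000) (s₀ := 914033 / 1000000) (Kp := 3142 / 2625)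
    (by norm_num) (by norm_num) (by norm_num) (by norm_num) (by norm_num) (by norm_num) (by norm_num) (by norm_num) (by norm_num) (by norm_num) (by norm_num)
    (by norm_num) (by norm_num) hgap

end Summit.Ventures.YMGap.RobustBall

end
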